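import Summits.RiemannHypothesis.RiemannHypothesis.Theorems.JensenPolynomialsSqrtLogRangeExplicit
import Mathlib.Analysis.SpecialFunctions.Log.Monotone

/-!
# The DIAGONAL corollary of rung J-P(P1″): `J^{d,n}_γ` is hyperbolic whenever `d ≤ n`
# (RH-FREE proof-of-data; cell rh-jensen, HUMAN RULING D-0040, ladder RH column JENSEN)

RH-FREE. For the Taylor data `γ = xiTaylorCoeff` of `ξ` (GORZ 2019: RH ⇔ every `J^{d,n}_γ`
hyperbolic), the explicit √d·log d range of `JensenPolynomialsSqrtLogRangeExplicit.lean`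
(`KimLee.jensenPoly_xiTaylorCoeff_splits_of_ge : 40·√d·log(20·√d) ≤ n ⇒` hyperbolic) together with
the tree's kernel certificate for `d ≤ 10⁶` (`jensenPoly_xiTaylorCoeff_splits_allShifts_of_le_1e6'`)
covers the whole half-grid on and below the diagonal:

* `jensenPoly_xiTaylorCoeff_splits_of_degree_le_shift` : for ALL `d n : ℕ` with `d ≤ n`, `J^{d,n}_γ` is
  hyperbolic (for `d ≤ 10⁶` every shift is certified; for `d > 10⁶`,
  `40√d·log(20√d) ≤ 0.4·d ≤ d ≤ n` since `log s / s ≤ log 10³/10³ ≤ 0.007` for `s = √d ≥ 10³`).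

In GORZ's notation: `N(d) ≤ d` for every degree `d` (explicitly; the sharper `N(d) ≤ 40√d·log(20√d)`
is the rung itself). WHAT THIS IS NOT: the half-grid `d ≤ n` is a hyperbolicity RANGE with
`N(d) → ∞`, inside Farmer's class (tree barriers
`Literature.Barriers.RiemannHypothesis.JensenPolynomials{,ShiftUniform,Sqrt,Cone}`); RH is the OTHER
half-grid too (`d > n`, in particular the row `n = 0`); nothing here bears on zeros of `ζ` off the
critical line or on the truth of RH. Landed `--supports stmt-RiemannHypothesis-19715` by
prover-rh-jensen-prover-g6-0.

## References
* [KimLee2021] Y.-O. Kim, J. Lee, J. Korean Math. Soc. 59 (2022) 775–787 = arXiv:2105.05386, Thm. 1.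
* [GORZPNAS2019] Griffin–Ono–Rolen–Zagier, PNAS 116 (2019) 11103–11110, Thm. 1.
-/

noncomputable section
-- D-0017: `Summit.RiemannHypothesis.RiemannHypothesis.…` duplicates the namespace BY DESIGN (single-problem summit).
set_option linter.dupNamespace false

open Polynomial

namespace Summit.RiemannHypothesis.RiemannHypothesis.Theorems.JensenPolynomials.KimLee

open Literature.NumberTheory.LFunctions

/-- For `s ≥ 1000`: `40·log(20·s) ≤ s` (`log s/s ≤ log 10³/10³ ≤ 0.007`, `log 20 < 3`). [folklore] -/
theorem forty_mul_log_le {s : ℝ} (hs : 1000 ≤ s) : 40 * Real.log (20 * s) ≤ s := by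
  have hs0 : 0 < s := by linarith
  have he : Real.exp 1 ≤ (1000 : ℝ) := by
    have := Real.exp_one_lt_d9; linarith
  have hanti := Real.log_div_self_antitoneOn (Set.mem_Ici.2 he) (Set.mem_Ici.2 (he.trans hs)) hs
  simp only at hanti
  -- `log 1000 ≤ 7` (`e⁷ > 1096`; cf. `Literature.Analysis.FluidPDE.Elgindi.log_thousand_le_seven`)
  have hl : Real.log 1000 ≤ 7 := by
    have h1 : (2.7182818283 : ℝ) < Real.exp 1 := Real.exp_one_gt_d9
    have h7 : (2.7182818283 : ℝ) ^ 7 ≤ Real.exp 1 ^ 7 := pow_le_pow_left₀ (by norm_num) h1.le 7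
    have h7' : Real.exp 1 ^ 7 = Real.exp 7 := by rw [← Real.exp_nat_mul]; norm_num
    have hbig : (1000 : ℝ) ≤ Real.exp 7 := by
      rw [← h7']
      have h1096 : (1000 : ℝ) ≤ (2.7182818283 : ℝ) ^ 7 := by norm_num
      exact h1096.trans h7
    exact (Real.log_le_iff_le_exp (by norm_num)).2 hbig
  have h1 : Real.log s ≤ s * 0.007 := by
    have h2 : Real.log s / s ≤ 0.007 := hanti.trans (by rw [div_le_iff₀ (by norm_num)]; linarith)
    rwa [div_le_iff₀ hs0, mul_comm] at h2
  have h20 : Real.log 20 < 3 := by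
    rw [Real.log_lt_iff_lt_exp (by norm_num)]
    have h1 : (2.7182818283 : ℝ) < Real.exp 1 := Real.exp_one_gt_d9
    have h3 : Real.exp 3 = Real.exp 1 ^ 3 := by rw [← Real.exp_nat_mul]; norm_num
    rw [h3]
    have : (2.7182818283 : ℝ) ^ 3 ≤ Real.exp 1 ^ 3 := pow_le_pow_left₀ (by norm_num) h1.le 3
    nlinarith
  rw [Real.log_mul (by norm_num) hs0.ne']
  linarith

/-- **THE DIAGONAL (RH-FREE): for all `d ≤ n`, the Jensen polynomial `J^{d,n}_γ` of `ξ`'s Taylor data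
is hyperbolic** — i.e. `N(d) ≤ d` for every degree. Degrees `d ≤ 10⁶`: every shift (tree certificate);
`d > 10⁶`: `40√d·log(20√d) ≤ d ≤ n` and the explicit √d·log d range.
[cite: KimLee2021, Theorem 1] [cite: GORZPNAS2019, Thm. 1] -/
theorem jensenPoly_xiTaylorCoeff_splits_of_degree_le_shift (d n : ℕ) (hdn : d ≤ n) :
    (jensenPoly xiTaylorCoeff d n).Splits := by
  by_cases hd : d ≤ 1000000
  · exact jensenPoly_xiTaylorCoeff_splits_allShifts_of_le_1e6' hd n
  · push Not at hd
    refine jensenPoly_xiTaylorCoeff_splits_of_ge d n ?_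
    have hd' : (1000000 : ℝ) ≤ d := by exact_mod_cast hd.le
    have hdn' : (d : ℝ) ≤ n := by exact_mod_cast hdn
    have hsd : (1000 : ℝ) ≤ Real.sqrt d := by
      rw [show (1000 : ℝ) = Real.sqrt (1000 ^ 2) by rw [Real.sqrt_sq (by norm_num)]]
      exact Real.sqrt_le_sqrt (by linarith)
    have hs0 : 0 ≤ Real.sqrt (d : ℝ) := Real.sqrt_nonneg _
    have hs2 : Real.sqrt (d : ℝ) ^ 2 = d := Real.sq_sqrt (by positivity)
    have h40 := forty_mul_log_le hsd
    calc 40 * Real.sqrt d * Real.log (20 * Real.sqrt d)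
        = Real.sqrt d * (40 * Real.log (20 * Real.sqrt d)) := by ring
      _ ≤ Real.sqrt d * Real.sqrt d := mul_le_mul_of_nonneg_left h40 hs0
      _ = d := by rw [← sq, hs2]
      _ ≤ n := hdn'

/-- The diagonal in the `JensenHyperbolicFrom` vocabulary: `N(d) ≤ d` for every `d`.
[cite: KimLee2021, Theorem 1] -/
theorem jensenHyperbolicFrom_xiTaylorCoeff_self (d : ℕ) : JensenHyperbolicFrom xiTaylorCoeff d d :=
  fun n hn ↦ jensenPoly_xiTaylorCoeff_splits_of_degree_le_shift d n hn

end Summit.RiemannHypothesis.RiemannHypothesis.Theorems.JensenPolynomials.KimLee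

end
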